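import Summits.QuantumFields.BalabanUV.Beta.EriceFlowEnclosureInverseLawRate

/-!
# Beta / EriceFlowEnclosureInverseLawThird — INVERSION OF A LOGARITHMIC LAW TO THIRD ORDER (pure real analysis, SERVICE): if the
# Λ-coordinate obeys `Λ t = 1∕t + κ·log t + C + a·t + O(t²·(1 + |log t|)²)` at 0⁺ and σ is its eventual right inverse with σ → 0⁺ and
# y·σ y → 1, then THE INVERSE LAW TO ORDER 1∕y: `1∕σ y = y + κ·log y − C + κ²·(log y)∕y − (κ·C + a)∕y + O((1 + log y)²∕y²)` — the
# next term of P2 #36 `inverse_law_sharp` (which stopped at κ²·(log y)∕y + O(1∕y)); the letter of 1∕y is −(κC + a): the Λ-law's O(t)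
# coefficient a enters with a minus sign next to −κC (β-flow team, prover 2 = lower ∕ positivity side, unit `b2b-balaban-beta-bflow-p2`,
# gen 20; module P2 #36c; companions P2 #36 `…InverseLawRate` (orders (1 + log y)∕y and (log y)∕y), P2 #36b `…RunningCouplingRate` (the
# running coupling 1∕g²(y) to κ²(ln y)∕y), bflow-p1 #42 `…LambdaRateSharp` (the Λ-law to O(t)); the Λ-law's O(t) LETTER a_Λ = β₃∕β₀ −
# β₂²∕β₀² + β₂∕2 is a PAPER PREDICTION recorded in INFO I-bflowp2-g20-1 (journal [BFLOW-P2-G20-INFO1]) for bflow-p1's #42 (ii) item — NOT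
# a theorem of this file, which takes the third-order Λ-law as a HYPOTHESIS SHAPE)

HONEST FRAMING (page 1 of everything the β sub-cell writes): discharging `BetaPertH` makes Bałaban's UV stability UNCONDITIONAL — a
real constructive-QFT result; it is NOT the continuum limit and NOT the Clay problem.  HONEST DEPENDENCY (cell reorg 2026-08-19,
verbatim): «continuum YM on T⁴ ⇐ BetaPertH ∧ nine spine estimates (0/9 proved); BetaPertH ⇐ (D1) ∧ (D4) ∧ CAP+tail; G-an2-4 gates
asym, D1 and NE2/3/4.»  THIS MODULE DISCHARGES NOTHING: [folklore] real analysis of one real function and its right inverse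
(`log x ≤ x − 1`, Mathlib's `Real.abs_log_sub_add_sum_range_le` for `|u + log(1 − u)| ≤ 2u²`, #41 `one_add_log_le_two_sqrt`); no Erice
sentence is consumed; «Λ-parameter» ∕ «running coupling» are bflow-p1's READINGS of (3.76) («+ O(1)», p. 250 — nothing finer in print).

WHAT THIS FILE PROVES (0 sorry, 0 def): `abs_log_sub_le_of_inv_eq` (1∕w = 1 − u, |u| ≤ 1∕2 ⟹ |log w − u| ≤ 2u²), `inverse_third_identity`
(the exact rearrangement at t = σ y, abstract letters), `inverse_third_remainder_le` (the five-term bound, abstract letters), `invLetter_unique`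
([folklore]: the 1∕y letter of such an expansion is unique — FORCED by the function), HEADLINE
**`inverse_law_third`** — hypotheses: `|Λ t − 1∕t − κ·log t − C − a·t| ≤ A·t²·(1 + |log t|)²` on ]0, t₁[ (A ≥ 0, t₁ > 0), `σ → 0⁺`,
`Λ (σ y) = y` eventually, `y·σ y → 1`; conclusion: eventually `|1∕σ y − y − κ·log y + C − κ²·(log y)∕y + (κ·C + a)∕y| ≤ A‴·(1 + log y)²∕y²`,
A‴ = κ²B + κ²B² + |κ|A₀ + 2|κ|B² + 2|a|B + 16A with A₀ = 2|a| + 64A, B = |C| + |κ| + A₀.  THE POINT: at t = σ y write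
E := y − 1∕t − κ log t − C = a·t + E₃ (|E₃| ≤ A t²(1 + |log t|)² ≤ 16A(1 + log y)²∕y²), u := (C + κ log t + E)∕y, 1∕(y t) = 1 − u,
log(y t) = u + r with |r| ≤ 2u²; P2 #36's identity `1∕t − y − κ log y + C − κ²(log y)∕y = −κC∕y − κ²(u + r)∕y − κE∕y − κr − E` plus
`E − a∕y = a·t·u + E₃` (from 1∕y = t(1 − u)) leaves `−κ²(u + r)∕y − κE∕y − κr − a·t·u − E₃ = O((1 + log y)²∕y²)`.
NOT CLAIMED: the Λ-law to third order itself (a HYPOTHESIS here); anything about (1.22); `BetaPertH`; continuum; Clay.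
-/

namespace Summit.QuantumFields.BalabanUV.Beta.EriceFlowEnclosureInverseLawThird

open Set Filter Topology
open Summit.QuantumFields.BalabanUV.Beta.EriceFlowEnclosureTwoLoopThreshold (one_add_log_le_two_sqrt)

noncomputable section

/-- If `1∕w = 1 − u` and `|u| ≤ 1∕2` then `|log w − u| ≤ 2u²` (log w = −log(1 − u), Mathlib's `log` conventions make `w > 0` unnecessary; Mathlib
`Real.abs_log_sub_add_sum_range_le`, n = 1). [folklore] -/
theorem abs_log_sub_le_of_inv_eq {w u : ℝ} (hinv : 1 / w = 1 - u) (hu : |u| ≤ 1 / 2) :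
    |Real.log w - u| ≤ 2 * u ^ 2 := by
  have hlogw : Real.log w = -Real.log (1 - u) := by
    rw [← hinv, one_div, Real.log_inv, neg_neg]
  have hx : |u| < 1 := by linarith
  have h := Real.abs_log_sub_add_sum_range_le hx 1
  simp only [Finset.sum_range_one, Nat.cast_zero, zero_add, pow_one, div_one] at h
  have h1 : |u| ^ (1 + 1) / (1 - |u|) ≤ 2 * u ^ 2 := by
    rw [show (1:ℕ) + 1 = 2 by norm_num, sq_abs, div_le_iff₀ (by linarith)]
    nlinarith [sq_nonneg u, abs_nonneg u]
  have e : Real.log w - u = -(u + Real.log (1 - u)) := by rw [hlogw]; ring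
  rw [e, abs_neg]
  exact h.trans h1

/-- **The exact rearrangement** (abstract letters; t, y > 0): with `E := y − 1∕t − κ log t − C`, `u := (C + κ log t + E)∕y`,
`r := log(y t) − u`, `E₃ := E − a t`:
`1∕t − y − κ log y + C − κ²(log y)∕y + (κC + a)∕y = −(κ²(u + r)∕y) − κE∕y − κr − a t u − E₃`. [folklore] -/
theorem inverse_third_identity {t y κ C a E u r E₃ : ℝ} (ht0 : 0 < t) (hy0 : 0 < y)
    (hE : E = y - 1 / t - κ * Real.log t - C) (hu : u = (C + κ * Real.log t + E) / y)
    (hr : r = Real.log (y * t) - u) (hE₃ : E₃ = E - a * t) :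
    1 / t - y - κ * Real.log y + C - κ ^ 2 * Real.log y / y + (κ * C + a) / y
      = -(κ ^ 2 * (u + r) / y) - κ * E / y - κ * r - a * t * u - E₃ := by
  have elogt : Real.log t = -Real.log y + u + r := by
    have := Real.log_mul hy0.ne' ht0.ne'
    rw [hr]; linarith
  have e1 : 1 / t - y - κ * Real.log y + C = -(κ * Real.log (y * t)) - E := by
    rw [hE, Real.log_mul hy0.ne' ht0.ne']; ring
  have e2 : Real.log (y * t) = u + r := by rw [hr]; ring
  have hyu0 : y * u = C + κ * Real.log t + E := by rw [hu]; field_simp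
  have hyu1 : y * u = y - 1 / t := by rw [hyu0, hE]; ring
  have hyu : y * u = C + κ * (-Real.log y + u + r) + E := by rw [hyu0, elogt]
  have hku : κ * u = κ * C / y - κ ^ 2 * Real.log y / y + κ ^ 2 * (u + r) / y + κ * E / y := by
    field_simp
    linear_combination κ * hyu
  -- 1∕y = t(1 − u): from y·u = y − 1∕t
  have key : y * t * (1 - u) = 1 := by
    have h2 : y * (1 - u) = 1 / t := by rw [mul_sub, mul_one, hyu1]; ring
    calc y * t * (1 - u) = t * (y * (1 - u)) := by ring
      _ = t * (1 / t) := by rw [h2]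
      _ = 1 := by field_simp
  have e3 : a / y = a * t - a * t * u := by
    have : a / y = a * (t * (1 - u)) := by
      field_simp
      linear_combination (-a) * key
    rw [this]; ring
  rw [show (κ * C + a) / y = κ * C / y + a / y by ring, e3, e1, e2, hE₃]
  linear_combination (-1 : ℝ) * hku

/-- **The five-term remainder bound** (abstract letters): with `y ≥ 2`, `0 < t ≤ 2∕y`, `L ≥ 1`, `B, A₀ ≥ 0`, `|u| ≤ BL∕y`,
`|r| ≤ 2B²L²∕y²`, `|E| ≤ A₀∕y`, `|E₃| ≤ 16AL²∕y²`:
`|−(κ²(u + r)∕y) − κE∕y − κr − a t u − E₃| ≤ (κ²B + κ²B² + |κ|A₀ + 2|κ|B² + 2|a|B + 16A)·L²∕y²` (A any real). [folklore] -/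
theorem inverse_third_remainder_le {t y κ a E u r E₃ B A₀ A L : ℝ} (hy2 : 2 ≤ y) (ht0 : 0 < t) (ht_le : t ≤ 2 / y)
    (hL1 : 1 ≤ L) (hB0 : 0 ≤ B) (hA₀ : 0 ≤ A₀)
    (hub : |u| ≤ B * L / y) (hrb : |r| ≤ 2 * B ^ 2 * L ^ 2 / y ^ 2) (hEb : |E| ≤ A₀ / y)
    (hE₃b : |E₃| ≤ 16 * A * L ^ 2 / y ^ 2) :
    |-(κ ^ 2 * (u + r) / y) - κ * E / y - κ * r - a * t * u - E₃|
      ≤ (κ ^ 2 * B + κ ^ 2 * B ^ 2 + |κ| * A₀ + 2 * |κ| * B ^ 2 + 2 * |a| * B + 16 * A) * L ^ 2 / y ^ 2 := by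
  have hy0 : 0 < y := by linarith
  have hy2sq : (0:ℝ) < y ^ 2 := by positivity
  have hL0 : 0 ≤ L := by linarith
  have t1 : |κ ^ 2 * (u + r) / y| ≤ (κ ^ 2 * B + κ ^ 2 * B ^ 2) * L ^ 2 / y ^ 2 := by
    rw [abs_div, abs_mul, abs_of_pos hy0, abs_of_nonneg (sq_nonneg κ)]
    have h1 : |u + r| ≤ B * L / y + 2 * B ^ 2 * L ^ 2 / y ^ 2 := (abs_add_le _ _).trans (add_le_add hub hrb)
    have hLL : L ≤ L ^ 2 := by nlinarith [hL1]
    have h2 : B * L / y ≤ B * L ^ 2 / y :=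
      div_le_div_of_nonneg_right (mul_le_mul_of_nonneg_left hLL hB0) hy0.le
    have h3 : 2 * B ^ 2 * L ^ 2 / y ^ 2 ≤ B ^ 2 * L ^ 2 / y := by
      rw [div_le_div_iff₀ hy2sq hy0]
      nlinarith [sq_nonneg B, sq_nonneg L, hy0, mul_nonneg (mul_nonneg (sq_nonneg B) (sq_nonneg L)) hy0.le]
    calc κ ^ 2 * |u + r| / y ≤ κ ^ 2 * (B * L ^ 2 / y + B ^ 2 * L ^ 2 / y) / y := by
          refine div_le_div_of_nonneg_right (mul_le_mul_of_nonneg_left (h1.trans (add_le_add h2 h3)) (sq_nonneg κ)) hy0.le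
      _ = (κ ^ 2 * B + κ ^ 2 * B ^ 2) * L ^ 2 / y ^ 2 := by field_simp
  have t2 : |κ * E / y| ≤ |κ| * A₀ * L ^ 2 / y ^ 2 := by
    rw [abs_div, abs_mul, abs_of_pos hy0]
    calc |κ| * |E| / y ≤ |κ| * (A₀ / y) / y := div_le_div_of_nonneg_right (mul_le_mul_of_nonneg_left hEb (abs_nonneg κ)) hy0.le
      _ = |κ| * A₀ / y ^ 2 := by field_simp
      _ ≤ |κ| * A₀ * L ^ 2 / y ^ 2 := by
          refine div_le_div_of_nonneg_right ?_ hy2sq.le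
          exact le_mul_of_one_le_right (mul_nonneg (abs_nonneg κ) hA₀) (by nlinarith [hL1])
  have t3 : |κ * r| ≤ 2 * |κ| * B ^ 2 * L ^ 2 / y ^ 2 := by
    rw [abs_mul]
    calc |κ| * |r| ≤ |κ| * (2 * B ^ 2 * L ^ 2 / y ^ 2) := mul_le_mul_of_nonneg_left hrb (abs_nonneg _)
      _ = 2 * |κ| * B ^ 2 * L ^ 2 / y ^ 2 := by ring
  have t4 : |a * t * u| ≤ 2 * |a| * B * L ^ 2 / y ^ 2 := by
    rw [abs_mul, abs_mul, abs_of_pos ht0]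
    calc |a| * t * |u| ≤ |a| * (2 / y) * (B * L / y) :=
          mul_le_mul (mul_le_mul_of_nonneg_left ht_le (abs_nonneg a)) hub (abs_nonneg u) (by positivity)
      _ = 2 * |a| * B * L / y ^ 2 := by field_simp
      _ ≤ 2 * |a| * B * L ^ 2 / y ^ 2 := by
          refine div_le_div_of_nonneg_right ?_ hy2sq.le
          have hLL : L ≤ L ^ 2 := by nlinarith [hL1]
          exact mul_le_mul_of_nonneg_left hLL (by positivity)
  calc |-(κ ^ 2 * (u + r) / y) - κ * E / y - κ * r - a * t * u - E₃|
      ≤ |κ ^ 2 * (u + r) / y| + |κ * E / y| + |κ * r| + |a * t * u| + |E₃| := by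
        have a1 := abs_sub (-(κ ^ 2 * (u + r) / y) - κ * E / y - κ * r - a * t * u) E₃
        have a2 := abs_sub (-(κ ^ 2 * (u + r) / y) - κ * E / y - κ * r) (a * t * u)
        have a3 := abs_sub (-(κ ^ 2 * (u + r) / y) - κ * E / y) (κ * r)
        have a4 := abs_sub (-(κ ^ 2 * (u + r) / y)) (κ * E / y)
        rw [abs_neg] at a4
        linarith
    _ ≤ _ := by
        have := add_le_add (add_le_add (add_le_add (add_le_add t1 t2) t3) t4) hE₃b
        refine this.trans (le_of_eq ?_)
        field_simp

/-- **INVERSION TO THIRD ORDER (pure real analysis): the coefficient of 1∕y is −(κC + a).**  If `|Λ t − 1∕t − κ·log t − C − a·t| ≤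
A·t²·(1 + |log t|)²` on ]0, t₁[ (A ≥ 0, t₁ > 0), σ is an eventual right inverse of Λ with `σ y → 0⁺` and `y·σ y → 1`, then eventually
`|1∕σ y − y − κ·log y + C − κ²·(log y)∕y + (κ·C + a)∕y| ≤ A‴·(1 + log y)²∕y²` with A‴ = κ²B + κ²B² + |κ|A₀ + 2|κ|B² + 2|a|B + 16A,
A₀ = 2|a| + 64A, B = |C| + |κ| + A₀. [folklore] -/
theorem inverse_law_third {Λ σ : ℝ → ℝ} {κ C a A t₁ : ℝ} (hA : 0 ≤ A)
    (hlaw : ∀ t ∈ Ioo 0 t₁, |Λ t - 1 / t - κ * Real.log t - C - a * t| ≤ A * t ^ 2 * (1 + |Real.log t|) ^ 2)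
    (hσ0 : Tendsto σ atTop (𝓝[>] 0)) (hσ : ∀ᶠ y in atTop, Λ (σ y) = y)
    (hone : Tendsto (fun y => y * σ y) atTop (𝓝 1)) (ht₁ : 0 < t₁) :
    ∀ᶠ y in atTop, |1 / σ y - y - κ * Real.log y + C - κ ^ 2 * Real.log y / y + (κ * C + a) / y|
      ≤ (κ ^ 2 * (|C| + |κ| + (2 * |a| + 64 * A)) + κ ^ 2 * (|C| + |κ| + (2 * |a| + 64 * A)) ^ 2
          + |κ| * (2 * |a| + 64 * A) + 2 * |κ| * (|C| + |κ| + (2 * |a| + 64 * A)) ^ 2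
          + 2 * |a| * (|C| + |κ| + (2 * |a| + 64 * A)) + 16 * A) * (1 + Real.log y) ^ 2 / y ^ 2 := by
  have hmem : ∀ᶠ y in atTop, σ y ∈ Ioo 0 t₁ := hσ0 (Ioo_mem_nhdsGT ht₁)
  have hlo : ∀ᶠ y in atTop, 1 / 2 < y * σ y := hone.eventually (lt_mem_nhds (by norm_num))
  have hhi : ∀ᶠ y in atTop, y * σ y < 2 := hone.eventually (gt_mem_nhds (by norm_num))
  obtain ⟨A₀, hA₀⟩ : ∃ A₀ : ℝ, A₀ = 2 * |a| + 64 * A := ⟨_, rfl⟩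
  obtain ⟨B, hB⟩ : ∃ B : ℝ, B = |C| + |κ| + A₀ := ⟨_, rfl⟩
  have hA₀nn : 0 ≤ A₀ := by rw [hA₀]; positivity
  have hB0 : 0 ≤ B := by rw [hB]; positivity
  have hsmallu : ∀ᶠ y : ℝ in atTop, B * (1 + Real.log y) / y ≤ 1 / 2 := by
    have hlogdiv : Tendsto (fun y : ℝ => Real.log y / y) atTop (𝓝 0) := Real.isLittleO_log_id_atTop.tendsto_div_nhds_zero
    have hinv : Tendsto (fun y : ℝ => 1 / y) atTop (𝓝 0) := tendsto_const_nhds.div_atTop tendsto_id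
    have h : Tendsto (fun y : ℝ => B * (1 / y + Real.log y / y)) atTop (𝓝 0) := by
      have := (hinv.add hlogdiv).const_mul B; rwa [add_zero, mul_zero] at this
    have h2 := h.eventually (gt_mem_nhds (by norm_num : (0:ℝ) < 1 / 2))
    filter_upwards [h2, eventually_gt_atTop (0:ℝ)] with y hy hy0
    have e : B * (1 + Real.log y) / y = B * (1 / y + Real.log y / y) := by field_simp
    rw [e]; exact hy.le
  filter_upwards [hmem, hσ, hlo, hhi, eventually_ge_atTop (2 : ℝ), hsmallu] with y ht he hlo hhi hy2 hsu
  set t := σ y with htdef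
  have ht0 : 0 < t := ht.1
  have hy0 : 0 < y := by linarith
  have hlogy : 0 ≤ Real.log y := Real.log_nonneg (by linarith)
  obtain ⟨L, hL⟩ : ∃ L : ℝ, L = 1 + Real.log y := ⟨_, rfl⟩
  have hL1 : 1 ≤ L := by rw [hL]; linarith
  have hL2y : L ^ 2 ≤ 4 * y := by
    have h1 := one_add_log_le_two_sqrt hy0
    rw [hL]
    calc (1 + Real.log y) ^ 2 ≤ (2 * Real.sqrt y) ^ 2 := pow_le_pow_left₀ (by linarith) h1 2
      _ = 4 * y := by rw [mul_pow, Real.sq_sqrt hy0.le]; ring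
  have hLaw := hlaw t ht
  rw [he] at hLaw
  have ht_le : t ≤ 2 / y := by rw [le_div_iff₀ hy0]; linarith
  have ht_ge : 1 / (2 * y) ≤ t := by rw [div_le_iff₀ (by linarith)]; linarith
  have htle1 : t ≤ 1 := ht_le.trans (by rw [div_le_one hy0]; linarith)
  have hlogt : |Real.log t| ≤ Real.log y + 1 := by
    have hneg : Real.log t ≤ 0 := Real.log_nonpos ht0.le htle1
    rw [abs_of_nonpos hneg]
    have h1 : Real.log (1 / (2 * y)) ≤ Real.log t := Real.log_le_log (by positivity) ht_ge
    rw [one_div, Real.log_inv, Real.log_mul (by norm_num) hy0.ne'] at h1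
    have h2 : Real.log 2 ≤ 1 := by
      have := Real.log_le_sub_one_of_pos (by norm_num : (0:ℝ) < 2); linarith
    linarith
  -- letters E, E₃, u, r
  set E : ℝ := y - 1 / t - κ * Real.log t - C with hE
  set E₃ : ℝ := E - a * t with hE₃
  set u : ℝ := (C + κ * Real.log t + E) / y with hu
  set r : ℝ := Real.log (y * t) - u with hr
  have hE₃b : |E₃| ≤ 16 * A * L ^ 2 / y ^ 2 := by
    have h0 : E₃ = y - 1 / t - κ * Real.log t - C - a * t := by simp only [hE₃, hE]
    have h1 : (1 + |Real.log t|) ^ 2 ≤ (2 * L) ^ 2 :=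
      pow_le_pow_left₀ (by positivity) (by rw [hL]; linarith) 2
    have h2 : t ^ 2 ≤ (2 / y) ^ 2 := pow_le_pow_left₀ ht0.le ht_le 2
    rw [h0]
    calc |y - 1 / t - κ * Real.log t - C - a * t| ≤ A * t ^ 2 * (1 + |Real.log t|) ^ 2 := hLaw
      _ ≤ A * (2 / y) ^ 2 * (2 * L) ^ 2 :=
          mul_le_mul (mul_le_mul_of_nonneg_left h2 hA) h1 (by positivity) (by positivity)
      _ = 16 * A * L ^ 2 / y ^ 2 := by field_simp; ring
  have hE₃b' : |E₃| ≤ 64 * A / y := by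
    refine hE₃b.trans ?_
    rw [div_le_div_iff₀ (by positivity) hy0]
    have := mul_le_mul_of_nonneg_left hL2y (by positivity : 0 ≤ 16 * A * y)
    nlinarith [this]
  have hEb : |E| ≤ A₀ / y := by
    have h0 : E = a * t + E₃ := by simp only [hE₃]; ring
    rw [h0, hA₀]
    calc |a * t + E₃| ≤ |a * t| + |E₃| := abs_add_le _ _
      _ ≤ |a| * (2 / y) + 64 * A / y := by
          rw [abs_mul, abs_of_pos ht0]
          exact add_le_add (mul_le_mul_of_nonneg_left ht_le (abs_nonneg a)) hE₃b'
      _ = (2 * |a| + 64 * A) / y := by ring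
  have hEb' : |E| ≤ A₀ := hEb.trans (by rw [div_le_iff₀ hy0]; nlinarith)
  have hub : |u| ≤ B * L / y := by
    rw [hu, abs_div, abs_of_pos hy0]
    refine div_le_div_of_nonneg_right ?_ hy0.le
    calc |C + κ * Real.log t + E| ≤ |C| + |κ * Real.log t| + |E| := abs_add_three _ _ _
      _ ≤ |C| + |κ| * (Real.log y + 1) + A₀ := by
          rw [abs_mul]; exact add_le_add (add_le_add le_rfl (mul_le_mul_of_nonneg_left hlogt (abs_nonneg _))) hEb'
      _ ≤ B * L := by
          rw [hB, hL]; nlinarith [abs_nonneg C, abs_nonneg κ, mul_nonneg (abs_nonneg C) hlogy, mul_nonneg hA₀nn hlogy]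
  have hu_half : |u| ≤ 1 / 2 := hub.trans (by rw [hL]; exact hsu)
  -- 1∕(y t) = 1 − u, log(y t) = −log(1 − u) = u + r with |r| ≤ 2u²
  have hinvw : 1 / (y * t) = 1 - u := by
    have : 1 / t = y - C - κ * Real.log t - E := by simp only [hE]; ring
    rw [hu, one_div, mul_inv, ← one_div t, this]
    field_simp
    ring
  have hrb : |r| ≤ 2 * B ^ 2 * L ^ 2 / y ^ 2 := by
    have h1 : u ^ 2 ≤ (B * L / y) ^ 2 := by
      rw [← sq_abs u]; exact pow_le_pow_left₀ (abs_nonneg _) hub 2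
    calc |r| = |Real.log (y * t) - u| := by rw [hr]
      _ ≤ 2 * u ^ 2 := abs_log_sub_le_of_inv_eq hinvw hu_half
      _ ≤ 2 * (B * L / y) ^ 2 := by linarith
      _ = 2 * B ^ 2 * L ^ 2 / y ^ 2 := by rw [div_pow, mul_pow]; ring
  rw [inverse_third_identity (κ := κ) (C := C) (a := a) ht0 hy0 hE hu hr hE₃]
  have hmain := inverse_third_remainder_le (κ := κ) (a := a) hy2 ht0 ht_le hL1 hB0 hA₀nn hub hrb hEb hE₃b
  rw [hB, hA₀, hL] at hmain
  exact hmain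

/-- **THE 1∕y LETTER IS UNIQUE** ([folklore]): if a real function G satisfies eventually `|G y − b∕y| ≤ A(1 + log y)²∕y²` and
`|G y − b′∕y| ≤ A′(1 + log y)²∕y²`, then `b = b′` — so the letter −(κC + a) of `inverse_law_third` is FORCED by the running coupling
(apply with `G y := 1∕σ y − y − κ·log y + C − κ²·(log y)∕y`). -/
theorem invLetter_unique {G : ℝ → ℝ} {b b' A A' : ℝ}
    (h : ∀ᶠ y in atTop, |G y - b / y| ≤ A * (1 + Real.log y) ^ 2 / y ^ 2)
    (h' : ∀ᶠ y in atTop, |G y - b' / y| ≤ A' * (1 + Real.log y) ^ 2 / y ^ 2) : b = b' := by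
  -- |b − b′| ≤ (A + A′)(1 + log y)²∕y eventually, and the right side → 0
  have hlogdiv : Tendsto (fun y : ℝ => Real.log y / y) atTop (𝓝 0) := Real.isLittleO_log_id_atTop.tendsto_div_nhds_zero
  have hlog2 : Tendsto (fun y : ℝ => Real.log y ^ 2 / y) atTop (𝓝 0) := by
    have := Real.tendsto_pow_log_div_mul_add_atTop 1 0 2 one_ne_zero
    simpa using this
  have hinv : Tendsto (fun y : ℝ => 1 / y) atTop (𝓝 0) := tendsto_const_nhds.div_atTop tendsto_id
  have hw : Tendsto (fun y : ℝ => (1 + Real.log y) ^ 2 / y) atTop (𝓝 0) := by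
    have h3 := (hinv.add (hlogdiv.const_mul 2)).add hlog2
    rw [mul_zero, add_zero, add_zero] at h3
    refine h3.congr' ?_
    filter_upwards [eventually_gt_atTop (0 : ℝ)] with y hy
    field_simp
    ring
  have hR : Tendsto (fun y : ℝ => (A + A') * ((1 + Real.log y) ^ 2 / y)) atTop (𝓝 ((A + A') * 0)) := hw.const_mul _
  rw [mul_zero] at hR
  have hev : ∀ᶠ y in atTop, |b - b'| ≤ (A + A') * ((1 + Real.log y) ^ 2 / y) := by
    filter_upwards [h, h', eventually_gt_atTop (0 : ℝ)] with y hy hy' hy0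
    have e : b - b' = y * ((G y - b' / y) - (G y - b / y)) := by field_simp; ring
    rw [e, abs_mul, abs_of_pos hy0]
    calc y * |(G y - b' / y) - (G y - b / y)| ≤ y * (A' * (1 + Real.log y) ^ 2 / y ^ 2 + A * (1 + Real.log y) ^ 2 / y ^ 2) :=
          mul_le_mul_of_nonneg_left ((abs_sub _ _).trans (add_le_add hy' hy)) hy0.le
      _ = (A + A') * ((1 + Real.log y) ^ 2 / y) := by field_simp; ring
  have := le_of_tendsto_of_tendsto tendsto_const_nhds hR hev
  have h0 : |b - b'| = 0 := le_antisymm this (abs_nonneg _)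
  linarith [abs_eq_zero.mp h0]

end

end Summit.QuantumFields.BalabanUV.Beta.EriceFlowEnclosureInverseLawThird
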